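import Summits.Ventures.PackingBounds.Configurations.LeechSections
import Summits.Ventures.PackingBounds.Configurations.CohnLi
import Summits.Ventures.PackingBounds.Kissing.DimensionSixteen

/-!
# The Barnes–Wall section of the Leech lattice: `κ(16) ≥ 4320` in Lean

Framing: lottery ticket; floor = certified bounds/negative ranges. Venture `PackingBounds` (cell
`pub-packcert`, seat `pub-packcert-energy`).

The Leech minimal vectors vanishing on a fixed octad `O` (here octad number `24` of our enumeration, the octad
through the coordinates `0,1,2,3,4`, namely `{0,1,2,3,4,13,15,20}`) are the `4320` minimal vectors of the
Barnes–Wall lattice `Λ₁₆ = BW₁₆` [Conway–Sloane, Ch. 4 §10, Ch. 6]: `4 · C(16,2) = 480` of shape `A` and `128`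
sign patterns on each of the `30` octads disjoint from `O`; no shape-`C` vector (all its coordinates are odd). They
lie in the `16`-dimensional coordinate subspace `O^⊥`, so they give a kissing configuration of `ℝ¹⁶`:
**`κ(16) ≥ 4320`** — the best lower bound known — and with the cell's LP certificate the bracket
`4320 ≤ κ(16) ≤ 8313`.

## References
* J. H. Conway, N. J. A. Sloane, *Sphere Packings, Lattices and Groups*, Ch. 1 Table 1.2, Ch. 4 §10, Ch. 6 Table 6.1. [`ConwaySloane1999`]
-/

namespace Summit.Ventures.PackingBounds.Config.Leech

open Finset Golay

local notation "E24" => EuclideanSpace ℝ (Fin 24)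

/-- The reference octad: number `24` in our enumeration (`= {0,1,2,3,4,13,15,20}`, the octad through `0,…,4`). -/
def oct16 : Fin 759 := ⟨24, by norm_num⟩

/-- The Barnes–Wall section: Leech minimal vectors vanishing on the octad `oct16`. -/
noncomputable def sec16 : Finset (Fin 24 → ℤ) := leechInt.filter fun y => ∀ j ∈ osupp oct16, y j = 0

attribute [irreducible] sec16

/-- Shape-`C` vectors never vanish on a coordinate. -/
theorem cvec_apply_ne_zero (i : Fin 24) (u : ℕ) (j : Fin 24) : cvec i u j ≠ 0 := by
  rcases cvec_apply_cases i u j with ⟨_, h | h⟩ | ⟨_, h | h⟩ <;> rw [h] <;> norm_num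

/-- `(0 : Fin 24)` lies in the reference octad. -/
theorem zero_mem_oct16 : (0 : Fin 24) ∈ osupp oct16 := by
  rw [oct16]; decide +kernel

/-- A shape-`B` vector vanishes on `oct16` iff its octad avoids `oct16`. -/
theorem bvec_vanish_iff (o : Fin 759) (v : ℕ) :
    (∀ j ∈ osupp oct16, bvec o v j = 0) ↔ ∀ j ∈ osupp oct16, j ∉ osupp o := by
  refine forall₂_congr fun j _ => ?_
  exact bvec_eq_zero_iff o v j

set_option maxRecDepth 100000 in
/-- Kernel counts: `480` shape-`A` vectors vanish on `oct16`, and `30` octads avoid it. -/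
theorem card_sec16_parts :
    (idxA.filter fun p => ∀ j ∈ osupp oct16, avec p.1.1 p.1.2 p.2.1 p.2.2 j = 0).card = 480 ∧
    (univ.filter fun o : Fin 759 => ∀ j ∈ osupp oct16, j ∉ osupp o).card = 30 := by
  rw [idxA, oct16]
  constructor <;> decide +kernel

/-- **`|sec16| = 480 + 30 · 128 + 0 = 4320`.** [cite: ConwaySloane1999, Ch. 6 Table 6.1] -/
theorem card_sec16 : sec16.card = 4320 := by
  have hB : ((univ ×ˢ range 128).filter fun p : Fin 759 × ℕ => ∀ j ∈ osupp oct16, bvec p.1 p.2 j = 0).card = 3840 := by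
    rw [Finset.filter_congr (fun p _ => bvec_vanish_iff p.1 p.2),
      Finset.filter_product_left (fun o : Fin 759 => ∀ j ∈ osupp oct16, j ∉ osupp o), card_product, card_range,
      card_sec16_parts.2]
  have hC : ((univ ×ˢ range 4096).filter fun p : Fin 24 × ℕ => ∀ j ∈ osupp oct16, cvec p.1 p.2 j = 0).card = 0 := by
    rw [Finset.card_eq_zero, Finset.filter_eq_empty_iff]
    intro p _ h
    exact cvec_apply_ne_zero p.1 p.2 0 (h 0 zero_mem_oct16)
  have hA := card_sec16_parts.1
  have key := card_filter_leechInt (fun y => ∀ j ∈ osupp oct16, y j = 0) hA hB hC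
  rw [sec16, key]

/-- Members of `sec16`. -/
theorem mem_sec16 {y : Fin 24 → ℤ} (hy : y ∈ sec16) : y ∈ leechInt ∧ ∀ j ∈ osupp oct16, y j = 0 := by
  rw [sec16] at hy; simpa using hy

/-- **`κ(16) ≥ 4320`**: the Barnes–Wall kissing configuration, `4320` unit vectors of `ℝ¹⁶` with pairwise inner
products `≤ 1/2`. [cite: ConwaySloane1999, Ch. 1 Table 1.2] -/
theorem exists_kissing_4320 : ∃ C : Finset (EuclideanSpace ℝ (Fin 16)),
    C.card = 4320 ∧ (∀ x ∈ C, ‖x‖ = 1) ∧ (∀ x ∈ C, ∀ y ∈ C, x ≠ y → inner ℝ x y ≤ 1 / 2) := by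
  have hS : sec16 ⊆ leechInt := fun y hy => (mem_sec16 hy).1
  -- normals: the coordinate vectors of the octad, indexed by `Fin 8` through the octad enumeration
  let u : Fin 8 → E24 := fun r => EuclideanSpace.single ((opos oct16 r : osupp oct16) : Fin 24) (1 : ℝ)
  have hu : LinearIndependent ℝ u := by
    have ho := EuclideanSpace.orthonormal_single (𝕜 := ℝ) (ι := Fin 24)
    have hf : Function.Injective (fun r : Fin 8 => ((opos oct16 r : osupp oct16) : Fin 24)) := by
      intro r r' h
      exact (opos oct16).injective (Subtype.ext h)
    exact (ho.comp _ hf).linearIndependent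
  have horth : ∀ x ∈ sec16.image (toE 32), ∀ r, inner ℝ (u r) x = 0 := by
    intro x hx r
    obtain ⟨y, hy, rfl⟩ := mem_image.mp hx
    rw [EuclideanSpace.inner_single_left, map_one, one_mul, toE_apply, (mem_sec16 hy).2 _ (opos oct16 r).2]
    simp
  obtain ⟨C', hc, hn, hi, _⟩ := exists_transfer_orthogonal (m := 24) (n := 16) (k := 8) rfl u hu
    (sec16.image (toE 32)) horth
  obtain ⟨h1, h2, h3⟩ := kissing_of_transfer hS hc hn hi
  exact ⟨C', by rw [h1, card_sec16], h2, h3⟩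

/-- **`4320 ≤ κ(16) ≤ 8313` in Lean.** [cite: ConwaySloane1999, Ch. 1 Table 1.2] -/
theorem kissing_dim16_bracket' :
    (∃ C : Finset (EuclideanSpace ℝ (Fin 16)), C.card = 4320 ∧ (∀ x ∈ C, ‖x‖ = 1) ∧
      (∀ x ∈ C, ∀ y ∈ C, x ≠ y → inner ℝ x y ≤ 1 / 2)) ∧
    ∀ C : Finset (EuclideanSpace ℝ (Fin 16)), (∀ x ∈ C, ‖x‖ = 1) →
      (∀ x ∈ C, ∀ y ∈ C, x ≠ y → inner ℝ x y ≤ 1 / 2) → C.card ≤ 8313 :=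
  ⟨exists_kissing_4320, Kissing.kissing_dim16_le_8313⟩

end Summit.Ventures.PackingBounds.Config.Leech
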